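import Summits.ResolutionOfSingularities.ResolutionOfSingularities.Theorems.EquisingularLiftDefs
import Literature.AlgebraicGeometry.Resolution.RegularBlowup
import Literature.AlgebraicGeometry.Resolution.BlowupsProperProofs
import HarnessLib

/-!
# Crux `EquisingularLift` (stmt-ResolutionOfSingularities-15660), line `strata-split`:
# stub `chain_isRegular`

Along a recursor-encoded chain of blow-ups in REGULAR centres (`Split.Chain P Y P' σ S'`, the fifth
conjunct of `EquisingularLift`) starting from a locally Noetherian regular scheme `P`, every stage is
locally Noetherian and regular and the composite structure morphism is proper. The proof applies the
induction principle `Split.Chain` to the motive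
`fun X' σ' _ => IsLocallyNoetherian X' ∧ Scheme.IsRegular X' ∧ IsProper σ'`:

* base: `IsProper (𝟙 P)` is an instance;
* step (`τ : X'' ⟶ X'` a blow-up of the locally Noetherian regular `X'` along an ideal sheaf `C` with
  regular `C.subscheme`): `τ` is proper (`IsBlowup.isProper`, Görtz–Wedhorn I, Prop. 13.96 (1)), hence
  locally of finite type, so `X''` is locally Noetherian (Mathlib
  `LocallyOfFiniteType.isLocallyNoetherian`); `X''` is regular by Liu, Thm. 8.1.19 (a)
  (`IsBlowup.isRegular_of_isRegular_subscheme`); and `τ ≫ σ'` is proper by composition.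

This is the same argument as the tree's `IsRegularCentreBlowupSeq.isLocallyNoetherian_and_isRegular`
(`Literature/AlgebraicGeometry/Resolution/RegularBlowup.lean`), transcribed to the recursor encoding.
-/

set_option linter.dupNamespace false -- mandated namespace of this single-conjunct summit

open CategoryTheory AlgebraicGeometry TopologicalSpace
open Literature.AlgebraicGeometry.Resolution

namespace Summit.ResolutionOfSingularities.ResolutionOfSingularities.Cruxes.EquisingularLift.StrataSplit

/-- **STUB `chain_isRegular` (known; Liu, Thm. 8.1.19 (a) iterated).** If `(P', σ, S')` is reached
from `(P, 𝟙, Y)` by a chain of blow-ups in regular centres (`Split.Chain P Y P' σ S'`) and `P` is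
locally Noetherian and regular, then `P'` is locally Noetherian and regular and `σ : P' ⟶ P` is
proper. Induction along the chain with the motive "locally Noetherian ∧ regular ∧ proper structure
morphism": each blow-up of a locally Noetherian scheme is proper (`IsBlowup.isProper`), hence locally
of finite type, so the new stage is locally Noetherian (`LocallyOfFiniteType.isLocallyNoetherian`);
it is regular by Liu, Thm. 8.1.19 (a) (`IsBlowup.isRegular_of_isRegular_subscheme`); properness
composes. Registered stub `chain_isRegular` of the line `strata-split` of crux
stmt-ResolutionOfSingularities-15660. [cite: Liu2002, Thm. 8.1.19 (a)] -/
theorem chain_isRegular : ∀ (P : AlgebraicGeometry.Scheme.{0}) (Y : Set P)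
    (P' : AlgebraicGeometry.Scheme.{0}) (σ : P' ⟶ P) (S' : Set P'),
    Summit.ResolutionOfSingularities.ResolutionOfSingularities.Theses.EquisingularLift.Split.Chain
      P Y P' σ S' →
    IsLocallyNoetherian P → Literature.AlgebraicGeometry.Resolution.Scheme.IsRegular P →
    IsLocallyNoetherian P' ∧ Literature.AlgebraicGeometry.Resolution.Scheme.IsRegular P' ∧
      AlgebraicGeometry.IsProper σ := by
  intro P Y P' σ S' h hN hR
  refine h (fun X' σ' _ => IsLocallyNoetherian X' ∧ Scheme.IsRegular X' ∧ IsProper σ')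
    ⟨hN, hR, inferInstance⟩ ?_
  intro X' X'' σ' _ C τ hQ hτ hC _
  obtain ⟨hN', hR', hσ'⟩ := hQ
  haveI := hN'
  haveI := hσ'
  haveI : IsProper τ := hτ.isProper
  exact ⟨LocallyOfFiniteType.isLocallyNoetherian τ, hτ.isRegular_of_isRegular_subscheme hR' hC,
    inferInstance⟩

end Summit.ResolutionOfSingularities.ResolutionOfSingularities.Cruxes.EquisingularLift.StrataSplit
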